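import Summits.KontsevichZagierPeriods.KontsevichZagierPeriods.Theorems.RootDecompRelativeModAbsoluteCylLogSplitP03

/-! # `RootDecompRelativeModAbsoluteCylLogSplitP04` — part 4/25 of the mechanical ≤330-line split of `CylLogSplit.lean`
(split by the decomp-kz census seat for landing; mathematics unchanged; part 4 continues part 3). -/

noncomputable section
open Set MeasureTheory Filter Topology
open scoped BigOperators
open Literature.NumberTheory.Transcendental Literature.ModelTheory.ExponentialFields

namespace Summit.KontsevichZagierPeriods.RootDecompRelativeModAbsolute.Rung30571

namespace RegularisedLogLayer

namespace CylLog
variable {b : ℕ}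

/-- **`RegTorusProductPos` — the positively oriented product rule for REGULARISED logarithmic cells,
PROVED unconditionally** (all `m : ℕ`, any base dimension; `m = 0` is the landed
`KZ.of_sub_of_sub_mem_relations_mul` plus `[G, 0] ∈ relations`).  Over an open `ℚ`-semialgebraic base
`G` with `u` differentiable and `u, w ≥ 1`:
`[{1≤t≤uw}, d(t−1)^m/t] − [{1≤t≤u}, d(t−1)^m/t] − [{1≤s≤w}, d(s−1)^m/s] − [G, d·ρ_m(u,w)] ∈ KZ.relations`. -/
theorem regTorusProductPos {b m : ℕ} {G : Set (Fin b → ℝ)} {d u w : (Fin b → ℝ) → ℝ}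
    (hGo : IsOpen G) (hG : IsSemialgebraic ℚ G) (hd : IsSemialgebraicFunOn ℚ G d)
    (hu : IsSemialgebraicFunOn ℚ G u) (hw : IsSemialgebraicFunOn ℚ G w)
    (hud : DifferentiableOn ℝ u G) (hu1 : ∀ x ∈ G, 1 ≤ u x) (hw1 : ∀ x ∈ G, 1 ≤ w x)
    (R R₁ R₂ : KZ.IntegralRep (b + 1)) (B : KZ.IntegralRep b)
    (hRd : R.domain = KZlog.band G (fun _ => 1) (fun x => u x * w x))
    (hRi : EqOn R.integrand
      (fun z => d (Fin.init z) * ((z (Fin.last b) - 1) ^ m / z (Fin.last b))) R.domain)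
    (hR₁d : R₁.domain = KZlog.band G (fun _ => 1) u)
    (hR₁i : EqOn R₁.integrand
      (fun z => d (Fin.init z) * ((z (Fin.last b) - 1) ^ m / z (Fin.last b))) R₁.domain)
    (hR₂d : R₂.domain = KZlog.band G (fun _ => 1) w)
    (hR₂i : EqOn R₂.integrand
      (fun z => d (Fin.init z) * ((z (Fin.last b) - 1) ^ m / z (Fin.last b))) R₂.domain)
    (hBd : B.domain = G) (hBi : EqOn B.integrand (fun x => d x * rho m (u x) (w x)) B.domain) :
    KZ.of R - KZ.of R₁ - KZ.of R₂ - KZ.of B ∈ KZ.relations := by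
  have hc1 : IsSemialgebraicFunOn ℚ G (fun _ => (1 : ℝ)) := by
    simpa using isSemialgebraicFunOn_ratCast hG 1
  have hbw : IsSemialgebraic ℚ (KZlog.band G (fun _ => 1) w) := KZlog.isSemialgebraic_band hc1 hw
  have hGm : MeasurableSet G := hG.measurableSet_holds
  have hBm : MeasurableSet (KZlog.band G (fun _ => 1) w) := hbw.measurableSet_holds
  have hband_sub : KZlog.band G (fun _ => 1) w ⊆ {z : Fin (b + 1) → ℝ | Fin.init z ∈ G} :=
    fun z hz => hz.1
  -- the rescaled integrand is semialgebraic on the band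
  have hdI : IsSemialgebraicFunOn ℚ (KZlog.band G (fun _ => 1) w) (fun z => d (Fin.init z)) :=
    hd.comp_init.mono hband_sub hbw
  have huI : IsSemialgebraicFunOn ℚ (KZlog.band G (fun _ => 1) w) (fun z => u (Fin.init z)) :=
    hu.comp_init.mono hband_sub hbw
  have hsI : IsSemialgebraicFunOn ℚ (KZlog.band G (fun _ => 1) w) (fun z => z (Fin.last b)) :=
    isSemialgebraicFunOn_apply hbw (Fin.last b)
  have hlin : IsSemialgebraicFunOn ℚ (KZlog.band G (fun _ => 1) w)
      (fun z => u (Fin.init z) * z (Fin.last b) - 1) :=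
    (IsSemialgebraicFunOn.sub_holds (IsSemialgebraicFunOn.mul_holds huI hsI)
      (isSemialgebraicFunOn_ratCast hbw 1)).congr fun z _ => by simp
  have hpow := isSemialgebraicFunOn_pow' hbw hlin m
  have hinv : IsSemialgebraicFunOn ℚ (KZlog.band G (fun _ => 1) w) (fun z => 1 / z (Fin.last b)) :=
    (isSemialgebraicFunOn_aeval_div_aeval hbw 1 (MvPolynomial.X (Fin.last b)) fun z hz => by
      simpa using (one_pos.trans_le hz.2.1).ne').congr fun z _ => by simp
  have hSsa : IsSemialgebraicFunOn ℚ (KZlog.band G (fun _ => 1) w)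
      (fun z => d (Fin.init z) * ((u (Fin.init z) * z (Fin.last b) - 1) ^ m / z (Fin.last b))) :=
    (IsSemialgebraicFunOn.mul_holds hdI (IsSemialgebraicFunOn.mul_holds hpow hinv)).congr
      fun z _ => by simp [div_eq_mul_inv]
  -- … and integrable there (Tonelli + the fibre estimate `lintegral_scaled_kernel_le`)
  have hK : IntegrableOn (fun x => ∫ t in Icc ((fun _ : Fin b → ℝ => (1 : ℝ)) x) (u x * w x),
      |d x * ((t - 1) ^ m / t)|) G :=
    integrableOn_fibre_abs_band R hRd hGm (F := fun x t => d x * ((t - 1) ^ m / t))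
      fun x hx t ht => by
        have hmem : (Fin.snoc x t : Fin (b + 1) → ℝ) ∈ R.domain := by
          rw [hRd, KZlog.snoc_mem_band]; exact ⟨hx, ht⟩
        rw [hRi hmem]
        simp only [Fin.init_snoc, Fin.snoc_last]
  have hSint : IntegrableOn
      (fun z : Fin (b + 1) → ℝ =>
        d (Fin.init z) * ((u (Fin.init z) * z (Fin.last b) - 1) ^ m / z (Fin.last b)))
      (KZlog.band G (fun _ => 1) w) := by
    refine KZlog.integrableOn_band_of_lintegral_fibre_le hGm (a := fun _ => (1 : ℝ)) (b := w) hBm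
      (fun x t => KZlog.snoc_mem_band) (KZ.aestronglyMeasurable_of_isSemialgebraicFunOn hSsa hBm)
      (K := fun x => ∫ t in Icc ((fun _ : Fin b → ℝ => (1 : ℝ)) x) (u x * w x),
        |d x * ((t - 1) ^ m / t)|) (fun x hx => ?_) hK
    simp only [Fin.init_snoc, Fin.snoc_last]
    exact lintegral_scaled_kernel_le m (d x) (hu1 x hx) (hw1 x hx)
  let S : KZ.IntegralRep (b + 1) :=
    { domain := KZlog.band G (fun _ => 1) w
      integrand := fun z =>
        d (Fin.init z) * ((u (Fin.init z) * z (Fin.last b) - 1) ^ m / z (Fin.last b))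
      isSemialgebraic_domain := hbw
      isSemialgebraicFunOn_integrand := hSsa
      integrableOn := hSint }
  exact regTorusProductPos_core hGo hG hd hu hw hud hu1 hw1 R R₁ R₂ S B hRd hRi hR₁d hR₁i hR₂d
    hR₂i rfl (fun _ _ => rfl) hBd hBi

/-! ### §3e Transport lemmas (general sub-band) and the mixed orientation `u ≥ 1 ≥ w`, `uw ≥ 1` — PROVED

The three reusable steps of §3c/§3d for an arbitrary sub-band: (T0) the fibre estimate under `t = u s`
for `[p,q] ↦ [up, uq] ⊆ [A, C]`; (T1) existence of the rescaled band `S = [{p≤s≤q}, d(us−1)^m/s]` as an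
honest representation whenever `[up, uq]` lies inside the fibres of an honest `t`-side representation, and
the rule-2 relation `[S] − [M] ∈ relations` for `M = [{up≤t≤uq}, d(t−1)^m/t]`; (T2) the polynomial band
`S − N` (`N = [{p≤s≤q}, d(s−1)^m/s]`) folds to the base `[G, d(Φ(q) − Φ(p))]`, `Φ(s) = polyLog m (us) − polyLog m s`. -/

/-- (T0) Fibre estimate under `t = υ s`: `∫_{[p,q]} |δ(υs−1)^m/s| ds = ∫_{[υp,υq]} |δ(t−1)^m/t| dt ≤ ∫_{[A,C]} …`. -/
theorem lintegral_scaled_kernel_le' (m : ℕ) (δ : ℝ) {υ p q A C : ℝ} (hυ : 0 < υ) (hp : 0 < p)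
    (hpq : p ≤ q) (hA : 0 < A) (hAp : A ≤ υ * p) (hqC : υ * q ≤ C) :
    ∫⁻ t in Icc p q, ‖δ * ((υ * t - 1) ^ m / t)‖ₑ ≤ ‖∫ t in Icc A C, |δ * ((t - 1) ^ m / t)|‖ₑ := by
  have hυpq : υ * p ≤ υ * q := mul_le_mul_of_nonneg_left hpq hυ.le
  have hAC : A ≤ C := hAp.trans (hυpq.trans hqC)
  set φ : ℝ → ℝ := fun t => |δ * ((t - 1) ^ m / t)| with hφ
  have hφ_nonneg : ∀ t, 0 ≤ φ t := fun t => abs_nonneg _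
  have hφ_cont : ContinuousOn φ (Icc A C) := by
    have h := continuousOn_scaled_kernel m δ 1 (Icc A C) (fun t ht => (hA.trans_le ht.1).ne')
    simpa [hφ] using h.abs
  have hφ_ii : IntervalIntegrable φ volume A C := hφ_cont.intervalIntegrable_of_Icc hAC
  set g : ℝ → ℝ := fun t => δ * ((υ * t - 1) ^ m / t) with hg
  have hg_cont : ContinuousOn g (Icc p q) :=
    continuousOn_scaled_kernel m δ υ (Icc p q) (fun t ht => (hp.trans_le ht.1).ne')
  have hg_int : IntegrableOn g (Icc p q) := hg_cont.integrableOn_compact isCompact_Icc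
  have hL : ∫⁻ t in Icc p q, ‖g t‖ₑ = ENNReal.ofReal (∫ t in Icc p q, ‖g t‖) :=
    (ofReal_integral_norm_eq_lintegral_enorm hg_int).symm
  have hpt : ∀ t ∈ Icc p q, ‖g t‖ = φ (υ * t) * υ := by
    intro t ht
    have ht0 : 0 < t := hp.trans_le ht.1
    have key : δ * ((υ * t - 1) ^ m / t) = δ * ((υ * t - 1) ^ m / (υ * t)) * υ := by
      field_simp
    rw [Real.norm_eq_abs]
    simp only [hg, hφ]
    rw [key, abs_mul, abs_of_pos hυ]
  have hK_nonneg : 0 ≤ ∫ t in Icc A C, φ t := setIntegral_nonneg measurableSet_Icc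
    fun t _ => hφ_nonneg t
  show ∫⁻ t in Icc p q, ‖g t‖ₑ ≤ ‖∫ t in Icc A C, φ t‖ₑ
  rw [hL, Real.enorm_eq_ofReal hK_nonneg]
  refine ENNReal.ofReal_le_ofReal ?_
  calc ∫ t in Icc p q, ‖g t‖ = ∫ t in Icc p q, φ (υ * t) * υ :=
        setIntegral_congr_fun measurableSet_Icc hpt
    _ = ∫ t in p..q, φ (υ * t) * υ := by
        rw [intervalIntegral.integral_of_le hpq, integral_Icc_eq_integral_Ioc]
    _ = ∫ t in υ * p..υ * q, φ t := by
        rw [intervalIntegral.integral_mul_const, mul_comm, intervalIntegral.mul_integral_comp_mul_left]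
    _ ≤ ∫ t in A..C, φ t :=
        intervalIntegral.integral_mono_interval hAp hυpq hqC
          (Filter.Eventually.of_forall fun t => hφ_nonneg t) hφ_ii
    _ = ∫ t in Icc A C, φ t := by
        rw [intervalIntegral.integral_of_le hAC, integral_Icc_eq_integral_Ioc]

/-- (T1, existence) The rescaled band `S = [{p ≤ s ≤ q}, d(us−1)^m/s]` is an honest representation as
soon as `[up, uq]` sits inside the fibres `[A, C]` (`A > 0`) of an honest representation `T` with integrand
`d(t−1)^m/t`. -/
theorem exists_scaledRep {b m : ℕ} {G : Set (Fin b → ℝ)} {d u p q A C : (Fin b → ℝ) → ℝ}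
    (hG : IsSemialgebraic ℚ G) (hd : IsSemialgebraicFunOn ℚ G d) (hu : IsSemialgebraicFunOn ℚ G u)
    (hp : IsSemialgebraicFunOn ℚ G p) (hq : IsSemialgebraicFunOn ℚ G q)
    (hu0 : ∀ x ∈ G, 0 < u x) (hp0 : ∀ x ∈ G, 0 < p x) (hpq : ∀ x ∈ G, p x ≤ q x)
    (T : KZ.IntegralRep (b + 1)) (hTd : T.domain = KZlog.band G A C)
    (hTi : EqOn T.integrand
      (fun z => d (Fin.init z) * ((z (Fin.last b) - 1) ^ m / z (Fin.last b))) T.domain)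
    (hA0 : ∀ x ∈ G, 0 < A x) (hAp : ∀ x ∈ G, A x ≤ u x * p x) (hqC : ∀ x ∈ G, u x * q x ≤ C x) :
    ∃ S : KZ.IntegralRep (b + 1), S.domain = KZlog.band G p q ∧
      S.integrand = fun z =>
        d (Fin.init z) * ((u (Fin.init z) * z (Fin.last b) - 1) ^ m / z (Fin.last b)) := by
  have hbpq : IsSemialgebraic ℚ (KZlog.band G p q) := KZlog.isSemialgebraic_band hp hq
  have hGm : MeasurableSet G := hG.measurableSet_holds
  have hBm : MeasurableSet (KZlog.band G p q) := hbpq.measurableSet_holds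
  have hband_sub : KZlog.band G p q ⊆ {z : Fin (b + 1) → ℝ | Fin.init z ∈ G} := fun z hz => hz.1
  have hdI : IsSemialgebraicFunOn ℚ (KZlog.band G p q) (fun z => d (Fin.init z)) :=
    hd.comp_init.mono hband_sub hbpq
  have huI : IsSemialgebraicFunOn ℚ (KZlog.band G p q) (fun z => u (Fin.init z)) :=
    hu.comp_init.mono hband_sub hbpq
  have hsI : IsSemialgebraicFunOn ℚ (KZlog.band G p q) (fun z => z (Fin.last b)) :=
    isSemialgebraicFunOn_apply hbpq (Fin.last b)
  have hlin : IsSemialgebraicFunOn ℚ (KZlog.band G p q)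
      (fun z => u (Fin.init z) * z (Fin.last b) - 1) :=
    (IsSemialgebraicFunOn.sub_holds (IsSemialgebraicFunOn.mul_holds huI hsI)
      (isSemialgebraicFunOn_ratCast hbpq 1)).congr fun z _ => by simp
  have hpow := isSemialgebraicFunOn_pow' hbpq hlin m
  have hinv : IsSemialgebraicFunOn ℚ (KZlog.band G p q) (fun z => 1 / z (Fin.last b)) :=
    (isSemialgebraicFunOn_aeval_div_aeval hbpq 1 (MvPolynomial.X (Fin.last b)) fun z hz => by
      simpa using ((hp0 _ hz.1).trans_le hz.2.1).ne').congr fun z _ => by simp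
  have hSsa : IsSemialgebraicFunOn ℚ (KZlog.band G p q)
      (fun z => d (Fin.init z) * ((u (Fin.init z) * z (Fin.last b) - 1) ^ m / z (Fin.last b))) :=
    (IsSemialgebraicFunOn.mul_holds hdI (IsSemialgebraicFunOn.mul_holds hpow hinv)).congr
      fun z _ => by simp [div_eq_mul_inv]
  have hK : IntegrableOn (fun x => ∫ t in Icc (A x) (C x), |d x * ((t - 1) ^ m / t)|) G :=
    integrableOn_fibre_abs_band T hTd hGm (F := fun x t => d x * ((t - 1) ^ m / t))
      fun x hx t ht => by
        have hmem : (Fin.snoc x t : Fin (b + 1) → ℝ) ∈ T.domain := by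
          rw [hTd, KZlog.snoc_mem_band]; exact ⟨hx, ht⟩
        rw [hTi hmem]
        simp only [Fin.init_snoc, Fin.snoc_last]
  have hSint : IntegrableOn
      (fun z : Fin (b + 1) → ℝ =>
        d (Fin.init z) * ((u (Fin.init z) * z (Fin.last b) - 1) ^ m / z (Fin.last b)))
      (KZlog.band G p q) := by
    refine KZlog.integrableOn_band_of_lintegral_fibre_le hGm (a := p) (b := q) hBm
      (fun x t => KZlog.snoc_mem_band) (KZ.aestronglyMeasurable_of_isSemialgebraicFunOn hSsa hBm)
      (K := fun x => ∫ t in Icc (A x) (C x), |d x * ((t - 1) ^ m / t)|) (fun x hx => ?_) hK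
    simp only [Fin.init_snoc, Fin.snoc_last]
    exact lintegral_scaled_kernel_le' m (d x) (hu0 x hx) (hp0 x hx) (hpq x hx) (hA0 x hx)
      (hAp x hx) (hqC x hx)
  exact ⟨{ domain := KZlog.band G p q
           integrand := fun z =>
             d (Fin.init z) * ((u (Fin.init z) * z (Fin.last b) - 1) ^ m / z (Fin.last b))
           isSemialgebraic_domain := hbpq
           isSemialgebraicFunOn_integrand := hSsa
           integrableOn := hSint }, rfl, rfl⟩

/-- (T1, relation) Rule 2 under `t = u s`: `[S] − [M] ∈ relations` for the rescaled band `S` on `[p, q]`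
and `M = [{up ≤ t ≤ uq}, d(t−1)^m/t]` (`G` open, `u > 0` differentiable, `p > 0`). -/
theorem of_scaled_sub_of_mem_relations {b m : ℕ} {G : Set (Fin b → ℝ)}
    {d u p q a' b' : (Fin b → ℝ) → ℝ} (hGo : IsOpen G) (hG : IsSemialgebraic ℚ G)
    (hu : IsSemialgebraicFunOn ℚ G u) (hud : DifferentiableOn ℝ u G) (hu0 : ∀ x ∈ G, 0 < u x)
    (hp0 : ∀ x ∈ G, 0 < p x) (S M : KZ.IntegralRep (b + 1)) (hSd : S.domain = KZlog.band G p q)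
    (hSi : EqOn S.integrand
      (fun z => d (Fin.init z) * ((u (Fin.init z) * z (Fin.last b) - 1) ^ m / z (Fin.last b)))
      S.domain)
    (hMd : M.domain = KZlog.band G a' b') (ha' : ∀ x ∈ G, a' x = u x * p x)
    (hb' : ∀ x ∈ G, b' x = u x * q x)
    (hMi : EqOn M.integrand
      (fun z => d (Fin.init z) * ((z (Fin.last b) - 1) ^ m / z (Fin.last b))) M.domain) :
    KZ.of S - KZ.of M ∈ KZ.relations := by
  refine KZ.of_sub_of_mem_relations_of_affine hGo (α := fun _ => 0) (β := u)
    (by simpa using isSemialgebraicFunOn_ratCast hG 0) hu (differentiableOn_const _) hud hu0 S M hSd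
    hMd (fun y hy => by rw [ha' y hy]; ring) (fun y hy => by rw [hb' y hy]; ring) fun z hz => ?_
  have hz' : z ∈ KZlog.band G p q := hSd ▸ hz
  obtain ⟨hx, hps, hsq⟩ := hz'
  have hux : 0 < u (Fin.init z) := hu0 _ hx
  have hu0' : u (Fin.init z) ≠ 0 := hux.ne'
  have hs0 : z (Fin.last b) ≠ 0 := ((hp0 _ hx).trans_le hps).ne'
  have hmem : (Fin.snoc (Fin.init z) (0 + u (Fin.init z) * z (Fin.last b)) : Fin (b + 1) → ℝ) ∈
      M.domain := by
    rw [hMd, KZlog.snoc_mem_band, ha' _ hx, hb' _ hx]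
    refine ⟨hx, ?_, ?_⟩
    · simpa using mul_le_mul_of_nonneg_left hps hux.le
    · simpa using mul_le_mul_of_nonneg_left hsq hux.le
  rw [hSi hz, hMi hmem]
  simp only [Fin.init_snoc, Fin.snoc_last, zero_add]
  field_simp

end CylLog
end RegularisedLogLayer
end Summit.KontsevichZagierPeriods.RootDecompRelativeModAbsolute.Rung30571
end
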